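import Summits.AtomisticToContinuum.BoseEinsteinCondensation.Theorems.BECGroundStateSOSLatticeODLROOffHalfFillingOfConcave
import Summits.AtomisticToContinuum.BoseEinsteinCondensation.Theorems.BECGroundStateSOSLatticeODLROOffHalfFillingStubGroundSectorOfTwistLemmas

/-!
# Crux `LatticeODLROOffHalfFilling` — ladder line, the registered stub `stub_groundSector_of_twist`

Route BECGroundStateSOS, crux stmt-AtomisticToContinuum-11033, line `Sketch`. Supports (does not close) the crux.

**Ground sectors from twist positivity.** On an even torus of side `L ≥ 4`, if the tracial ground state `ω₀` of
`H_{L,0}` (`Hmu L 0`, the `S = ½` XY Hamiltonian) satisfies `Re ω₀(e^{iθS³_tot}) ≥ 0` for every real `θ`, then every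
ground vector is half filled, `S³_tot v = 0`.

Proof. Let `P₀` be the ground projection, `d_σ = (P₀)_{σσ} = ‖P₀e_σ‖² ≥ 0`, `m_σ = L³/2 − #↓σ ∈ ℤ`.
* `Re tr(P₀ e^{iθS³}) = Σ_σ d_σ cos(θ m_σ) ≥ 0` (`S³_tot = diag(m)`, `tr P₀ > 0`).
* Sector sums `c_M = Σ_{m_σ = M} d_σ ∈ {0, 1}`: the columns `P₀e_σ` are `S³_tot`-eigen ground vectors (`col_facts`),
  hence sector ground vectors of `H_XY` (`stub_sectorGround`), hence multiples of the Perron–Frobenius vector `ψ` of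
  the sector (`SectorGroundStatePerron_proof`); if one of them is nonzero then `ψ` is a ground vector, `P₀ψ = ψ`, and
  reading this equation at a site where `ψ ≠ 0` gives `Σ_{m_σ = M} (P₀)_{σσ} = 1`.
* `c_{−M} = c_M`: the spin flip `U` permutes the basis (`U e_σ = e_{rev∘σ}`, `m_{rev∘σ} = −m_σ`), commutes with
  `H_{L,0}` hence with `P₀`, and is unitary, so `d_{rev∘σ} = d_σ`.
* The rigidity lemma `weights_eq_zero_of_sum_cos_nonneg` (sibling file) gives `d_σ = 0` whenever `m_σ ≠ 0`, i.e. the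
  column and (Hermiticity) the row `σ` of `P₀` vanish; so `v = P₀v` is supported on `m_σ = 0` and `S³_tot v = 0`.
All [folklore].
-/

noncomputable section

namespace Summit.AtomisticToContinuum.BoseEinsteinCondensation.Theorems.LatticeODLROOffHalfFilling.Ladder

open Literature.MathematicalPhysics.QuantumLattice Literature.Probability.LatticeModels Matrix Finset
open Summit.AtomisticToContinuum.BoseEinsteinCondensation.Theorems.LatticeODLROOffHalfFilling.Negative
open scoped ComplexOrder BigOperators

section General

variable {Λ : Type*} [Fintype Λ] [DecidableEq Λ]

/-- `S³_tot` is the diagonal matrix `diag(|Λ|/2 − #↓σ)`. [folklore] -/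
private theorem totalSpin_two_eq_diagonal :
    (totalSpin 1 2 : Op Λ 2) =
      diagonal (fun σ : TensorIndex Λ 2 => (Fintype.card Λ : ℂ) / 2 - (downCount σ : ℂ)) := by
  ext σ τ
  have h := congrFun (totalSpin_two_mulVec_single (Λ := Λ) τ) σ
  rw [mulVec_single_one, Matrix.col_apply] at h
  rw [h, diagonal_apply, Pi.smul_apply, Pi.single_apply, smul_eq_mul]
  by_cases hστ : σ = τ
  · subst hστ; simp
  · rw [if_neg hστ, if_neg hστ, mul_zero]

omit [Fintype Λ] [DecidableEq Λ] in
/-- The spin flip of configurations `σ ↦ rev ∘ σ` (`↑ ↔ ↓` at every site) is an involution.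
[folklore] -/
private theorem rev_comp_involutive :
    Function.Involutive (fun σ : TensorIndex Λ 2 => (Fin.rev ∘ σ : TensorIndex Λ 2)) :=
  fun _ => funext fun _ => Fin.rev_rev _

omit [DecidableEq Λ] in
/-- `#↓(rev ∘ σ) + #↓σ = |Λ|`. [folklore] -/
private theorem downCount_rev_comp (σ : TensorIndex Λ 2) :
    downCount (Fin.rev ∘ σ : TensorIndex Λ 2) + downCount σ = Fintype.card Λ := by
  have hrev : ∀ i : Fin 2, (i.rev = 1 ↔ ¬ i = 1) := by decide
  unfold downCount
  simp only [Function.comp_apply, hrev]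
  rw [add_comm, Finset.card_filter_add_card_filter_not, Finset.card_univ]

/-- Entries of `σˣ`. [folklore] -/
private theorem spinHalfPauli_zero_apply (i j : Fin 2) :
    spinHalfPauli 0 i j = if i = j.rev then 1 else 0 := by
  fin_cases i <;> fin_cases j <;> simp [spinHalfPauli]

/-- The flip operator permutes basis configurations: `U e_σ = e_{rev ∘ σ}`. [folklore] -/
private theorem flipOp_mulVec_single (σ : TensorIndex Λ 2) :
    (flipOp : Op Λ 2) *ᵥ Pi.single σ 1 = Pi.single (Fin.rev ∘ σ : TensorIndex Λ 2) 1 := by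
  rw [mulVec_single_one]
  ext τ
  rw [Matrix.col_apply, flipOp, productOp_apply]
  simp_rw [spinHalfPauli_zero_apply]
  rw [Fintype.prod_boole, Pi.single_apply]
  congr 1
  simp only [funext_iff, Function.comp_apply]

/-- Diagonal entries of an orthogonal projection are the squared norms of its columns. [folklore] -/
private theorem groundProj_apply_self {m : Type*} [Fintype m] [DecidableEq m] (A : Matrix m m ℂ) (σ : m) :
    A.groundProj σ σ = star (A.groundProj.col σ) ⬝ᵥ A.groundProj.col σ := by
  set P := A.groundProj with hP
  have hPH : Pᴴ = P := (groundProj_isHermitian A).eq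
  have hPP : P * P = P := groundProj_mul_self A
  calc P σ σ = (Pᴴ * P) σ σ := by rw [hPH, hPP]
    _ = ∑ τ, star (P τ σ) * P τ σ := by simp [Matrix.mul_apply, conjTranspose_apply]
    _ = star (P.col σ) ⬝ᵥ P.col σ := by simp [dotProduct, Matrix.col_apply]

end General

section Torus

variable (L : ℕ) [NeZero L]

/-- **One Perron vector per occupied sector.** If the column `P₀e_{σ₀}` of the ground projection of `H_{L,0}` is
nonzero, the Perron–Frobenius vector `ψ` of the sector of `σ₀` is a ground vector (`P₀ψ = ψ`), is supported on
that sector, and every column `P₀e_σ` of the sector is a multiple of `ψ`. [folklore] -/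
theorem exists_perron_of_col_ne_zero (hL : 4 ≤ L) (σ₀ : TensorIndex (TorusSite 3 L) 2)
    (hσ₀ : (Hmu L 0).groundProj.col σ₀ ≠ 0) :
    ∃ ψ : TensorIndex (TorusSite 3 L) 2 → ℂ, ∃ τ₀, ψ τ₀ ≠ 0 ∧ (Hmu L 0).groundProj *ᵥ ψ = ψ ∧
      (∀ σ, downCount σ ≠ downCount σ₀ → ψ σ = 0) ∧
      (∀ σ, downCount σ = downCount σ₀ → ∃ a : ℂ, (Hmu L 0).groundProj.col σ = a • ψ) := by
  have hL3 : 3 ≤ L := by omega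
  have hL2 : 2 ≤ L := by omega
  set P := (Hmu L 0).groundProj with hP
  have hcard : Fintype.card (TorusSite 3 L) = L ^ 3 := by simp [ZMod.card, Fintype.card_fin]
  have hdc : downCount σ₀ ≤ L ^ 3 := by
    rw [← hcard, downCount, ← Finset.card_univ]
    exact Finset.card_filter_le _ _
  set N : ℕ := L ^ 3 - downCount σ₀ with hN
  have hNle : N ≤ L ^ 3 := Nat.sub_le _ _
  set Mr : ℝ := (N : ℝ) - (L : ℝ) ^ 3 / 2 with hMr
  have hev : ∀ σ : TensorIndex (TorusSite 3 L) 2, downCount σ = downCount σ₀ →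
      ((L : ℝ) ^ 3 / 2 - (downCount σ : ℝ)) = Mr := by
    intro σ h
    rw [h, hMr, hN, Nat.cast_sub hdc]
    push_cast
    ring
  obtain ⟨ψ, hψ0, -, hψK, -, huniq⟩ :=
    Summit.AtomisticToContinuum.BoseEinsteinCondensation.Theorems.SectorGroundStatePerron_proof
      3 L (by norm_num) hL2 N hNle
  -- nonzero columns in the sector are multiples of `ψ`
  have hmult : ∀ σ, downCount σ = downCount σ₀ → P.col σ ≠ 0 → ∃ a : ℂ, P.col σ = a • ψ := by
    intro σ hσ hne
    obtain ⟨hmem, hS⟩ := col_facts L hL3 0 σ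
    rw [hev σ hσ] at hS
    exact huniq _ ((mem_spinZSector_iff L Mr _).mpr hS) (stub_sectorGround L 0 Mr _ hmem hS hne)
  -- `ψ` is a ground vector
  obtain ⟨a₀, ha₀⟩ := hmult σ₀ rfl hσ₀
  have ha₀ne : a₀ ≠ 0 := by
    rintro rfl
    rw [zero_smul] at ha₀
    exact hσ₀ ha₀
  have hψmem : ψ ∈ (Hmu L 0).groundSpace := by
    have h : ψ = a₀⁻¹ • P.col σ₀ := by rw [ha₀, smul_smul, inv_mul_cancel₀ ha₀ne, one_smul]
    rw [h]
    exact Submodule.smul_mem _ _ (col_facts L hL3 0 σ₀).1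
  have hPψ : P *ᵥ ψ = ψ := groundProj_mulVec_of_mem _ hψmem
  -- `ψ` is supported on the sector
  have hSψ := (mem_spinZSector_iff L Mr ψ).mp hψK
  have hsupp : ∀ σ, downCount σ ≠ downCount σ₀ → ψ σ = 0 := by
    intro σ hσ
    have h := congrFun hSψ σ
    rw [totalSpin_two_eq_diagonal, mulVec_diagonal, Pi.smul_apply, smul_eq_mul, hcard] at h
    have hne : (((L ^ 3 : ℕ) : ℂ) / 2 - (downCount σ : ℂ)) ≠ ((Mr : ℝ) : ℂ) := by
      intro heq
      apply hσ
      rw [hMr, hN, Nat.cast_sub hdc] at heq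
      push_cast at heq
      have h2 : ((downCount σ : ℝ) : ℂ) = ((downCount σ₀ : ℝ) : ℂ) := by
        push_cast
        linear_combination -heq
      exact_mod_cast h2
    rcases mul_eq_mul_right_iff.mp h with h' | h'
    · exact absurd h' hne
    · exact h'
  obtain ⟨τ₀, hτ₀⟩ := Function.ne_iff.mp hψ0
  refine ⟨ψ, τ₀, hτ₀, hPψ, hsupp, fun σ hσ => ?_⟩
  by_cases hcolz : P.col σ = 0
  · exact ⟨0, by rw [hcolz, zero_smul]⟩
  · exact hmult σ hσ hcolz

/-- **Occupied sectors carry total weight one**: under the conclusions of `exists_perron_of_col_ne_zero`,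
`Σ_{#↓σ = #↓σ₀} (P₀)_{σσ} = 1` (read `ψ = P₀ψ` at `τ₀`; the columns of the sector are rank one along `ψ`).
[folklore] -/
theorem sum_sector_diag_eq_one {ι : Type*} [Fintype ι] [DecidableEq ι] (P : Matrix ι ι ℂ) (dc : ι → ℕ)
    (σ₀ : ι) (ψ : ι → ℂ) (τ₀ : ι) (hτ₀ : ψ τ₀ ≠ 0) (hPψ : P *ᵥ ψ = ψ)
    (hsupp : ∀ σ, dc σ ≠ dc σ₀ → ψ σ = 0) (hmult : ∀ σ, dc σ = dc σ₀ → ∃ a : ℂ, P.col σ = a • ψ) :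
    ∑ σ ∈ univ.filter (fun σ => dc σ = dc σ₀), P σ σ = 1 := by
  have hrk : ∀ σ, dc σ = dc σ₀ → P σ σ * ψ τ₀ = P τ₀ σ * ψ σ := by
    intro σ hσ
    obtain ⟨a, ha⟩ := hmult σ hσ
    have h1 : P σ σ = a * ψ σ := by
      have := congrFun ha σ
      simpa [Matrix.col_apply] using this
    have h2 : P τ₀ σ = a * ψ τ₀ := by
      have := congrFun ha τ₀
      simpa [Matrix.col_apply] using this
    rw [h1, h2]
    ring
  have key : (∑ σ ∈ univ.filter (fun σ => dc σ = dc σ₀), P σ σ) * ψ τ₀ = ψ τ₀ := by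
    calc (∑ σ ∈ univ.filter (fun σ => dc σ = dc σ₀), P σ σ) * ψ τ₀
        = ∑ σ, P τ₀ σ * ψ σ := by
          rw [Finset.sum_mul, Finset.sum_filter]
          refine Finset.sum_congr rfl fun σ _ => ?_
          by_cases hσ : dc σ = dc σ₀
          · rw [if_pos hσ, hrk σ hσ]
          · rw [if_neg hσ, hsupp σ hσ, mul_zero]
      _ = (P *ᵥ ψ) τ₀ := rfl
      _ = ψ τ₀ := by rw [hPψ]
  exact (mul_eq_right₀ hτ₀).mp key

/-- **Ground sectors from twist positivity.** If `Re ω₀(e^{iθS³_tot}) ≥ 0` for every `θ` in the tracial ground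
state `ω₀` of `H_{L,0}` (`L ≥ 4` even), then every ground vector of `H_{L,0}` is half filled (`S³_tot v = 0`):
`Re tr(P₀ e^{iθS³_tot}) = Σ_M c_M cos(Mθ)` with `c_M = Σ_{m_σ = M}(P₀)_{σσ} ∈ {0,1}` (Perron–Frobenius uniqueness
per sector, `SectorGroundStatePerron_proof`, and `stub_sectorGround`), `c_{−M} = c_M` (spin flip), and the
rigidity of nonnegative `{0,1}`-valued even cosine sums (`weights_eq_zero_of_sum_cos_nonneg`) forces `c_M = 0` for
`M ≠ 0`, i.e. `P₀` lives on the half-filled sector. [folklore] -/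
theorem stub_groundSector_of_twist (L : ℕ) [NeZero L] (hL : 4 ≤ L) (hE : Even L)
    (htw : ∀ θ : ℝ, 0 ≤ ((Hmu L 0).groundStateFunctional
      (Matrix.diagonal (fun σ : TensorIndex (TorusSite 3 L) 2 =>
        Complex.exp (Complex.I * (θ : ℂ) * ((L : ℂ) ^ 3 / 2 - (downCount σ : ℂ)))))).re)
    (v : TensorIndex (TorusSite 3 L) 2 → ℂ) (hv : v ∈ (Hmu L 0).groundSpace) :
    (totalSpin 1 2 : Op (TorusSite 3 L) 2) *ᵥ v = 0 := by
  have hL3 : 3 ≤ L := by omega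
  have hHerm : (Hmu L 0).IsHermitian := Hmu_isHermitian L 0
  have hv' : (Hmu L 0).groundProj *ᵥ v = v := groundProj_mulVec_of_mem _ hv
  set P := (Hmu L 0).groundProj with hP
  have hPH : Pᴴ = P := (groundProj_isHermitian _).eq
  haveI : Nonempty (TensorIndex (TorusSite 3 L) 2) := ⟨fun _ => 0⟩
  -- half the volume and the integer magnetisation `m_σ = L³/2 − #↓σ`
  obtain ⟨h, hh⟩ : ∃ h : ℕ, L ^ 3 = h + h := Nat.even_pow.mpr ⟨hE, by norm_num⟩
  have hcard : Fintype.card (TorusSite 3 L) = L ^ 3 := by simp [ZMod.card, Fintype.card_fin]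
  set mz : TensorIndex (TorusSite 3 L) 2 → ℤ := fun σ => (h : ℤ) - (downCount σ : ℤ) with hmz
  have hmzC : ∀ σ : TensorIndex (TorusSite 3 L) 2,
      ((L : ℂ) ^ 3 / 2 - (downCount σ : ℂ)) = ((mz σ : ℤ) : ℂ) := by
    intro σ
    have h3 : (L : ℂ) ^ 3 = (h : ℂ) + h := by exact_mod_cast hh
    simp only [hmz]
    push_cast
    rw [h3]
    ring
  have hmC : ∀ σ : TensorIndex (TorusSite 3 L) 2,
      ((Fintype.card (TorusSite 3 L) : ℂ) / 2 - (downCount σ : ℂ)) = ((mz σ : ℤ) : ℂ) := by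
    intro σ
    rw [hcard, ← hmzC σ]
    push_cast
    ring
  -- the weights `d_σ = (P₀)_{σσ} = ‖P₀ e_σ‖²`
  set d : TensorIndex (TorusSite 3 L) 2 → ℝ := fun σ => (P σ σ).re with hd
  have hdiag : ∀ σ, P σ σ = star (P.col σ) ⬝ᵥ P.col σ := groundProj_apply_self (Hmu L 0)
  have hdre : ∀ σ, P σ σ = ((d σ : ℝ) : ℂ) := fun σ => by
    simp only [hd]
    rw [hdiag]
    exact star_dotProduct_self_eq_ofReal _
  have hnn : ∀ σ, 0 ≤ d σ := fun σ => by
    simp only [hd]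
    rw [hdiag]
    exact (Complex.nonneg_iff.mp (dotProduct_star_self_nonneg _)).1
  have hd0 : ∀ σ, d σ = 0 → P.col σ = 0 := by
    intro σ hσ
    by_contra hne
    have hpos := normSq_pos_of_ne_zero hne
    simp only [hd] at hσ
    rw [hdiag] at hσ
    linarith
  -- sector sums are `0` or `1`
  have h01 : ∀ M : ℤ, (∑ σ ∈ univ.filter (fun σ => mz σ = M), d σ) = 0 ∨
      (∑ σ ∈ univ.filter (fun σ => mz σ = M), d σ) = 1 := by
    intro M
    by_cases hex : ∃ σ₀, mz σ₀ = M ∧ P.col σ₀ ≠ 0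
    · obtain ⟨σ₀, rfl, hσ₀⟩ := hex
      right
      obtain ⟨ψ, τ₀, hτ₀, hPψ, hsupp, hmult⟩ := exists_perron_of_col_ne_zero L hL σ₀ hσ₀
      have hone := sum_sector_diag_eq_one P downCount σ₀ ψ τ₀ hτ₀ hPψ hsupp hmult
      have hfilt : univ.filter (fun σ => mz σ = mz σ₀) =
          univ.filter (fun σ : TensorIndex (TorusSite 3 L) 2 => downCount σ = downCount σ₀) := by
        ext σ
        simp only [mem_filter, mem_univ, true_and, hmz]
        omega
      rw [hfilt]
      have h1 : (((∑ σ ∈ univ.filter (fun σ : TensorIndex (TorusSite 3 L) 2 =>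
          downCount σ = downCount σ₀), d σ : ℝ)) : ℂ) = 1 := by
        rw [Complex.ofReal_sum, ← hone]
        exact Finset.sum_congr rfl fun σ _ => (hdre σ).symm
      exact_mod_cast h1
    · left
      push Not at hex
      refine Finset.sum_eq_zero fun σ hσ => ?_
      have hcol := hex σ (mem_filter.mp hσ).2
      simp only [hd]
      rw [hdiag, hcol]
      simp
  -- symmetry under the spin flip
  have hUH : (flipOp : Op (TorusSite 3 L) 2) * Hmu L 0 = Hmu L 0 * flipOp := by
    have h1 := flipOp_mul_hmu L hL3 0
    rwa [neg_zero] at h1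
  have hPU : P * flipOp = flipOp * P := groundProj_commute_of_commute hHerm hUH
  have hdflip : ∀ σ, d (Fin.rev ∘ σ) = d σ := by
    intro σ
    have hcol : P.col (Fin.rev ∘ σ) = flipOp *ᵥ P.col σ := by
      rw [← mulVec_single_one, ← flipOp_mulVec_single, mulVec_mulVec, hPU, ← mulVec_mulVec,
        mulVec_single_one]
    simp only [hd]
    rw [hdiag, hdiag, hcol, star_mulVec_dotProduct_mulVec flipOp_conjTranspose_mul]
  have hmzflip : ∀ σ, mz (Fin.rev ∘ σ) = -mz σ := by
    intro σ
    have h1 := downCount_rev_comp σ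
    rw [hcard, hh] at h1
    simp only [hmz]
    omega
  have hsym : ∀ M : ℤ, (∑ σ ∈ univ.filter (fun σ => mz σ = -M), d σ) =
      ∑ σ ∈ univ.filter (fun σ => mz σ = M), d σ := by
    intro M
    rw [Finset.sum_filter, Finset.sum_filter]
    rw [← Equiv.sum_comp (rev_comp_involutive (Λ := TorusSite 3 L)).toPerm
      (fun τ => if mz τ = M then d τ else 0)]
    refine Finset.sum_congr rfl fun σ _ => ?_
    simp only [Function.Involutive.coe_toPerm, hdflip σ, hmzflip σ, neg_eq_iff_eq_neg]
  -- positivity of the cosine transform, from `htw`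
  have hpos : ∀ θ : ℝ, 0 ≤ ∑ σ, d σ * Real.cos (θ * mz σ) := by
    intro θ
    have h0 := htw θ
    rw [groundStateFunctional_apply, ← hP] at h0
    have htr : (P * diagonal (fun σ : TensorIndex (TorusSite 3 L) 2 =>
        Complex.exp (Complex.I * (θ : ℂ) * ((L : ℂ) ^ 3 / 2 - (downCount σ : ℂ))))).trace =
        ∑ σ, P σ σ * Complex.exp (Complex.I * (θ : ℂ) * ((L : ℂ) ^ 3 / 2 - (downCount σ : ℂ))) := by
      simp [Matrix.trace, Matrix.mul_diagonal]
    have hre : (∑ σ, P σ σ * Complex.exp (Complex.I * (θ : ℂ) * ((L : ℂ) ^ 3 / 2 - (downCount σ : ℂ)))).re =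
        ∑ σ, d σ * Real.cos (θ * mz σ) := by
      rw [Complex.re_sum]
      refine Finset.sum_congr rfl fun σ _ => ?_
      rw [hmzC σ, hdre σ]
      have e : Complex.I * (θ : ℂ) * ((mz σ : ℤ) : ℂ) = ((θ * (mz σ : ℤ) : ℝ) : ℂ) * Complex.I := by
        push_cast
        ring
      rw [e, Complex.re_ofReal_mul, Complex.exp_ofReal_mul_I_re]
    obtain ⟨htre, htim⟩ := Complex.pos_iff.mp (trace_groundProj_pos hHerm)
    rw [← hP] at htre htim
    have ht : P.trace = ((P.trace.re : ℝ) : ℂ) := Complex.ext (by simp) (by simp [← htim])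
    rw [htr, ht, ← Complex.ofReal_inv, Complex.re_ofReal_mul, hre] at h0
    exact (mul_nonneg_iff_of_pos_left (inv_pos.mpr htre)).mp h0
  -- rigidity: the weights vanish off the half-filled sector
  have hvan := weights_eq_zero_of_sum_cos_nonneg d mz hnn h01 hsym hpos
  have hrow : ∀ σ, mz σ ≠ 0 → ∀ τ, P σ τ = 0 := by
    intro σ hσ τ
    have hcol := hd0 σ (hvan σ hσ)
    have h1 : P τ σ = 0 := by
      have := congrFun hcol τ
      simpa [Matrix.col_apply] using this
    rw [← hPH, conjTranspose_apply, h1, star_zero]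
  -- conclusion: `v = P₀ v` is supported on `m_σ = 0`
  funext σ
  rw [totalSpin_two_eq_diagonal, mulVec_diagonal, Pi.zero_apply, hmC σ]
  by_cases hσ : mz σ = 0
  · rw [hσ]
    simp
  · have hvσ : v σ = 0 := by
      rw [← hv']
      simp only [mulVec, dotProduct]
      exact Finset.sum_eq_zero fun τ _ => by rw [hrow σ hσ τ, zero_mul]
    rw [hvσ, mul_zero]

end Torus

end Summit.AtomisticToContinuum.BoseEinsteinCondensation.Theorems.LatticeODLROOffHalfFilling.Ladder

end
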